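import Mathlib.MeasureTheory.Measure.Haar.NormedSpace
import Mathlib.MeasureTheory.Measure.Lebesgue.EqHaar
import HarnessLib

/-!
# Route `SwapVirialDeficit` (YangMills): THE `p`-SCALING FUBINI ON THE BASE PLANE — hCore brick (v) of w3 g68's memo-hCore §2 (`p′ = √(1+|τ⃗|²)·p`)
# (cell ym-idea-1, skeleton ➎, `stub_core_tip`, the core; free-hands support of ⟨stmt-QuantumFields-24197⟩ `SwapVirialDeficit.SwapGluedStiffness`)

For a fixed joint tilt `τ⃗` the rotation identity ✓`exists_gnoRot_gnoBase_eq_jointTilt` reads the tip leader point over the base point `p` as a rotated flat point over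
`p′ = λ·p`, `λ = √(1+|τ⃗|²) ∈ [1, √2]` on the tube; so the apex reference weight `D_apex` appears at `λ·p` inside the `p`-integral.  Mathlib's additive-Haar scaling
(✓`Measure.integral_comp_smul`, `finrank ℝ (ℝ × ℝ) = 2`) moves it to the integration variable:
* `finrank_real_prod_real` (`= 2`); ★ `integral_comp_smul_plane` — `∫ G(λ•p) dp = (λ²)⁻¹·∫ G`; ★★ `integral_comp_smul_plane_weight` — `∫ G(λ•p)·W(p) dp = (λ²)⁻¹·∫ G(q)·W(λ⁻¹•q) dq`
  (`λ ≠ 0`; Bochner, junk-consistent, no integrability needed); ★ `lintegral_comp_smul_plane` — the `ℝ≥0∞` twin for measurable `G ≥ 0`.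
* ★ `baseWeight_inv_smul_le` — the integrable base weight `w₀(p) = (1+x₀²)⁻¹(1+y₀²)⁻¹` under the inverse scaling: `w₀(λ⁻¹•q) ≤ λ⁴·w₀(q)` for `1 ≤ λ` (so `≤ 4·w₀(q)` on the tube).

HONEST LABEL: generic measure bookkeeping; hCore and the assembly of `stub_core_tip`, ⟨24197⟩ ∕ ⟨24194⟩ remain OPEN; own crux ⟨22884⟩ `LargeFieldMassRefinementTail` OPEN (blocked-on
⟨19935⟩); the Yang–Mills mass gap is NOT proved; no summit is proved by a line.  THEOREMS ONLY (0 `def`, 0 `sorry`, no instance), standard axioms.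
Width seat ym-line-sfw-p2-w2 g61 (cell ym-idea-1, free hands), `--supports stmt-QuantumFields-24197`.  References: [folklore].
-/

set_option autoImplicit false

noncomputable section

open MeasureTheory Module
open scoped ENNReal

namespace Summit.QuantumFields.YangMills.Theorems.SwapVirialDeficit.SectorLaplace

/-- `dim_ℝ (ℝ × ℝ) = 2`. [folklore] -/
theorem finrank_real_prod_real : finrank ℝ (ℝ × ℝ) = 2 := by
  rw [Module.finrank_prod, Module.finrank_self]

/-- ★ **Scaling on the base plane**: `∫ G(λ•p) dp = (λ²)⁻¹·∫ G` for `0 ≤ λ` (additive Haar scaling, `finrank = 2`; Bochner, junk-consistent). [folklore] -/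
theorem integral_comp_smul_plane (G : ℝ × ℝ → ℝ) {lam : ℝ} (hlam : 0 ≤ lam) :
    ∫ p : ℝ × ℝ, G (lam • p) = (lam ^ 2)⁻¹ * ∫ p : ℝ × ℝ, G p := by
  haveI : (volume : Measure (ℝ × ℝ)).IsAddHaarMeasure := Measure.prod.instIsAddHaarMeasure _ _
  have h := Measure.integral_comp_smul_of_nonneg (volume : Measure (ℝ × ℝ)) G lam (hR := hlam)
  rw [finrank_real_prod_real, smul_eq_mul] at h
  exact h

/-- ★★ **Scaling with a weight**: `∫ G(λ•p)·W(p) dp = (λ²)⁻¹·∫ G(q)·W(λ⁻¹•q) dq` for `0 < λ` — the reference weight moves to the integration variable. [folklore] -/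
theorem integral_comp_smul_plane_weight (G W : ℝ × ℝ → ℝ) {lam : ℝ} (hlam : 0 < lam) :
    ∫ p : ℝ × ℝ, G (lam • p) * W p = (lam ^ 2)⁻¹ * ∫ q : ℝ × ℝ, G q * W (lam⁻¹ • q) := by
  have h := integral_comp_smul_plane (fun q : ℝ × ℝ => G q * W (lam⁻¹ • q)) hlam.le
  have e : (fun p : ℝ × ℝ => (fun q : ℝ × ℝ => G q * W (lam⁻¹ • q)) (lam • p)) = fun p => G (lam • p) * W p := by
    funext p
    simp only [smul_smul, inv_mul_cancel₀ hlam.ne', one_smul]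
  rw [e] at h
  exact h

/-- ★ **The `ℝ≥0∞` twin**: `∫⁻ G(λ•p) dp = ofReal((λ²)⁻¹)·∫⁻ G` for measurable `G` and `0 < λ`. [folklore] -/
theorem lintegral_comp_smul_plane (G : ℝ × ℝ → ℝ≥0∞) (hG : Measurable G) {lam : ℝ} (hlam : 0 < lam) :
    ∫⁻ p : ℝ × ℝ, G (lam • p) = ENNReal.ofReal ((lam ^ 2)⁻¹) * ∫⁻ p : ℝ × ℝ, G p := by
  haveI : (volume : Measure (ℝ × ℝ)).IsAddHaarMeasure := Measure.prod.instIsAddHaarMeasure _ _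
  have hmeas : Measurable fun p : ℝ × ℝ => lam • p := measurable_const_smul lam
  rw [← lintegral_map hG hmeas, Measure.map_addHaar_smul volume hlam.ne', lintegral_smul_measure, finrank_real_prod_real, smul_eq_mul,
    abs_of_nonneg (inv_nonneg.2 (pow_nonneg hlam.le _))]

/-- ★ **The base weight under the inverse scaling**: `w₀(λ⁻¹•q) ≤ λ⁴·w₀(q)` for `1 ≤ λ`, `w₀(p) = (1+x₀²)⁻¹(1+y₀²)⁻¹`. [folklore] -/
theorem baseWeight_inv_smul_le {lam : ℝ} (hlam : 1 ≤ lam) (q : ℝ × ℝ) :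
    (1 + (lam⁻¹ • q).1 ^ 2)⁻¹ * (1 + (lam⁻¹ • q).2 ^ 2)⁻¹ ≤ lam ^ 4 * ((1 + q.1 ^ 2)⁻¹ * (1 + q.2 ^ 2)⁻¹) := by
  have hlam0 : 0 < lam := by linarith
  simp only [Prod.smul_fst, Prod.smul_snd, smul_eq_mul]
  have hone : ∀ x : ℝ, (1 + (lam⁻¹ * x) ^ 2)⁻¹ ≤ lam ^ 2 * (1 + x ^ 2)⁻¹ := fun x => by
    have e : (1 + (lam⁻¹ * x) ^ 2)⁻¹ = lam ^ 2 / (lam ^ 2 + x ^ 2) := by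
      field_simp
    rw [e, ← div_eq_mul_inv]
    exact div_le_div_of_nonneg_left (by positivity) (by positivity) (by nlinarith)
  calc (1 + (lam⁻¹ * q.1) ^ 2)⁻¹ * (1 + (lam⁻¹ * q.2) ^ 2)⁻¹ ≤ (lam ^ 2 * (1 + q.1 ^ 2)⁻¹) * (lam ^ 2 * (1 + q.2 ^ 2)⁻¹) :=
        mul_le_mul (hone q.1) (hone q.2) (by positivity) (by positivity)
    _ = lam ^ 4 * ((1 + q.1 ^ 2)⁻¹ * (1 + q.2 ^ 2)⁻¹) := by ring

end Summit.QuantumFields.YangMills.Theorems.SwapVirialDeficit.SectorLaplace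

end
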